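import Mathlib.Data.Nat.ModEq
import Mathlib.Data.Nat.Factors
import Literature.Computability.Complexity.BoolEncodings
import Literature.Computability.Complexity.Classes
import Literature.Computability.Complexity.Nondeterministic
import Literature.Computability.Complexity.Reductions
import HarnessLib

/-!
# QUADRATIC CONGRUENCES (Garey–Johnson [AN1]; Manders–Adleman 1978)

The decision problem QUADRATIC CONGRUENCES of Garey–Johnson's catalogue, entry [AN1]
(§A7.1 "Divisibility problems"):

> INSTANCE: Positive integers `a`, `b`, and `c`.
> QUESTION: Is there a positive integer `x < c` such that `x² ≡ a (mod b)`?
> Reference: [Manders and Adleman, 1978]. Transformation from 3SAT.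
> Comment: Remains NP-complete even if the instance includes a prime factorization of `b` and
> solutions to the congruence modulo all prime powers occurring in the factorization. …

formalised in the style of `Literature/Computability/Complexity/KarpProblems.lean`: a math-level
set of yes-instances `quadCongSet ⊆ ℕ × ℕ × ℕ`, pushed through the Boolean encoding
`encodingQuadCong = encodingNatBool.pairBool (encodingNatBool.pairBool encodingNatBool)`, i.e.
`(a, b, c) ↦ boolPair (encodeNat a) (boolPair (encodeNat b) (encodeNat c))`, via
`Computability.Encoding.toLanguage`, giving `QUADCONG : Language Bool`; plus the variant
`QUADCONGFACT` whose instances additionally list the prime factorisation of `b`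
(`Nat.primeFactorsList b`, the primes with multiplicity in non-decreasing order) as a fourth
component. The two NP-completeness results are recorded as named facts
`isNPComplete_QUADCONG`, `isNPComplete_QUADCONGFACT : Prop` (not proved here).

## Sources

* M. R. Garey, D. S. Johnson, *Computers and Intractability*, Freeman 1979, §A7.1, problem [AN1]
  (statement and comment quoted above); §2.1 (the language `L[Π, e]` of a decision problem:
  encodings of YES-instances only, so strings that do not encode an instance — here triples with
  a zero entry — are outside the language).
* K. L. Manders, L. Adleman, *NP-complete decision problems for binary quadratics*, J. Comput.
  System Sci. 16 (1978) 168–184, §2: Theorem 2 (quadratic congruences with a bound on the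
  solution are NP-complete, by reduction from 3SAT; their side condition is `0 ≤ x ≤ γ`) and the
  Remark before the proof ("the problems are still NP-complete when `β` is given in fully
  factored form").
* K. Jansen, K.-M. Klein, A. Lassota, *The double exponential runtime is tight for 2-stage
  stochastic ILPs*, Math. Program. 197 (2022), §2 (restates the problem as `z ≤ γ`,
  `z² ≡ α mod β`; Thm 2 there claims NP-hardness for moduli whose odd part is squarefree).

## Conventions and design choices

* We follow Garey–Johnson's wording literally: `a, b, c` positive and the solution `x` ranges
  over `0 < x < c`. Manders–Adleman (and Jansen–Klein–Lassota) use `0 ≤ x ≤ γ` instead; the two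
  versions differ on individual instances (e.g. when `b ∣ a`, `x = 0` is a solution of the latter)
  but are interreducible by trivial polynomial-time case analysis, and both sources assert
  NP-completeness of their version. The positivity of `c` in `quadCongSet` is redundant
  (`0 < x < c` forces it) but kept so that the definition reads as printed; `mem_quadCongSet_iff`
  drops it.
* "The instance includes a prime factorization of `b`" is rendered by a second *encoding* of the
  same math-level set: `encodingQuadCongFactored` appends `encodingListNatBool.encode
  (Nat.primeFactorsList b)` to the code of `(a, b, c)` (decoding ignores it). Thus a string is in
  `QUADCONGFACT` iff it is the code of a yes-instance together with the CORRECT factorisation of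
  `b`; NP-hardness of `QUADCONGFACT` says precisely that reductions must output `b` in factored
  form, which is what Manders–Adleman's reduction does. Garey–Johnson's comment is stronger still
  (solutions modulo the prime powers may also be supplied); that refinement is not formalised.
* Mathlib has no decision-problem language for this (searched `QuadraticCongruence`, `QUADCONG`,
  `MandersAdleman`, `NPComplete`: nothing); `Nat.ModEq` (`x ^ 2 ≡ a [MOD b]`) and
  `Nat.primeFactorsList` are used as-is. `b = 0` never occurs in an instance, so Mathlib's
  convention `x ≡ a [MOD 0] ↔ x = a` is immaterial.
-/

namespace Literature.Computability.Complexity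

open _root_.Computability

/-! ### The problem [AN1] -/

/-- Yes-instances of QUADRATIC CONGRUENCES: triples `(a, b, c)` of POSITIVE integers such that
some positive integer `x < c` satisfies `x² ≡ a (mod b)` (Garey–Johnson's wording; the original,
Manders–Adleman 1978 §2 Theorem 2, has the side condition `0 ≤ x ≤ γ`).
[cite: GareyJohnson1979, §A7.1 problem AN1] -/
def quadCongSet : Set (ℕ × ℕ × ℕ) :=
  {p | (0 < p.1 ∧ 0 < p.2.1 ∧ 0 < p.2.2) ∧ ∃ x : ℕ, 0 < x ∧ x < p.2.2 ∧ x ^ 2 ≡ p.1 [MOD p.2.1]}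

/-- Unfolding lemma for `quadCongSet`, with the redundant positivity of `c` removed:
`(a, b, c)` is a yes-instance iff `a, b > 0` and some `x` with `0 < x < c` has
`x² ≡ a (mod b)`. [cite: GareyJohnson1979, §A7.1 problem AN1] -/
theorem mem_quadCongSet_iff (a b c : ℕ) :
    (a, b, c) ∈ quadCongSet ↔ 0 < a ∧ 0 < b ∧ ∃ x : ℕ, 0 < x ∧ x < c ∧ x ^ 2 ≡ a [MOD b] := by
  simp only [quadCongSet, Set.mem_setOf_eq]
  constructor
  · rintro ⟨⟨ha, hb, -⟩, h⟩
    exact ⟨ha, hb, h⟩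
  · rintro ⟨ha, hb, x, hx0, hxc, hx⟩
    exact ⟨⟨ha, hb, lt_of_le_of_lt (Nat.zero_le x) hxc⟩, x, hx0, hxc, hx⟩

/-- A yes-instance has `2 ≤ c` (there is an `x` with `0 < x < c`).
[cite: GareyJohnson1979, §A7.1 problem AN1] -/
theorem two_le_of_mem_quadCongSet {a b c : ℕ} (h : (a, b, c) ∈ quadCongSet) : 2 ≤ c := by
  obtain ⟨-, -, x, hx0, hxc, -⟩ := (mem_quadCongSet_iff a b c).1 h
  omega

/-- The standard Boolean encoding of instances `(a, b, c)`:
`boolPair (encodeNat a) (boolPair (encodeNat b) (encodeNat c))` (binary numerals, self-delimiting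
pairing; Garey–Johnson §2.1 "reasonable encoding schemes", realised with the `boolPair`
conventions of `BoolEncodings.lean`). [cite: AroraBarak2009, §0.1] -/
abbrev encodingQuadCong : Encoding (ℕ × ℕ × ℕ) Bool :=
  encodingNatBool.pairBool (encodingNatBool.pairBool encodingNatBool)

/-- The code of `(a, b, c)` under `encodingQuadCong`, in `boolPair` form. [folklore] -/
@[simp] theorem encodingQuadCong_encode (a b c : ℕ) :
    encodingQuadCong.encode (a, b, c) =
      boolPair (encodeNat a) (boolPair (encodeNat b) (encodeNat c)) :=
  rfl

/-- The language QUADRATIC CONGRUENCES over `{0,1}` (Garey–Johnson [AN1]): the codes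
`boolPair (encodeNat a) (boolPair (encodeNat b) (encodeNat c))` of the members of `quadCongSet`
(the language `L[AN1, e]` of Garey–Johnson §2.1; problem of Manders–Adleman 1978, §2 Theorem 2).
[cite: GareyJohnson1979, §A7.1 problem AN1] -/
def QUADCONG : Language Bool :=
  encodingQuadCong.toLanguage quadCongSet

/-- Membership of a code word in `QUADCONG` is membership of the instance in `quadCongSet`.
[folklore] -/
theorem boolPair_mem_QUADCONG_iff (a b c : ℕ) :
    boolPair (encodeNat a) (boolPair (encodeNat b) (encodeNat c)) ∈ QUADCONG ↔
      (a, b, c) ∈ quadCongSet :=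
  encodingQuadCong.mem_toLanguage_iff quadCongSet (a, b, c)

/-- `QUADCONG` as a set-builder over strings, fully unfolded: `w ∈ QUADCONG` iff `w` is the code
of positive `a, b, c` admitting `0 < x < c` with `x² ≡ a (mod b)`.
[cite: GareyJohnson1979, §A7.1 problem AN1] -/
theorem mem_QUADCONG_iff (w : List Bool) :
    w ∈ QUADCONG ↔ ∃ a b c : ℕ,
      w = boolPair (encodeNat a) (boolPair (encodeNat b) (encodeNat c)) ∧
        0 < a ∧ 0 < b ∧ ∃ x : ℕ, 0 < x ∧ x < c ∧ x ^ 2 ≡ a [MOD b] := by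
  constructor
  · rintro ⟨⟨a, b, c⟩, hp, rfl⟩
    exact ⟨a, b, c, rfl, (mem_quadCongSet_iff a b c).1 hp⟩
  · rintro ⟨a, b, c, rfl, h⟩
    exact ⟨(a, b, c), (mem_quadCongSet_iff a b c).2 h, rfl⟩

/-! ### The variant with the prime factorisation of `b` supplied -/

/-- The encoding of instances `(a, b, c)` that additionally lists the prime factorisation of `b`:
`boolPair (encodeNat a) (boolPair (encodeNat b) (boolPair (encodeNat c) (code of
b.primeFactorsList)))`, where `Nat.primeFactorsList b` is the list of prime factors of `b` with
multiplicity in non-decreasing order (e.g. `12 ↦ [2, 2, 3]`) and lists of naturals are coded by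
`encodingListNatBool`. Decoding reads the first three components and ignores the fourth. (Renders
"the instance includes a prime factorization of `b`", Garey–Johnson [AN1] Comment; "`β` given in
fully factored form", Manders–Adleman 1978 §2 Remark.)
[cite: GareyJohnson1979, §A7.1 problem AN1 (Comment)] -/
def encodingQuadCongFactored : Encoding (ℕ × ℕ × ℕ) Bool where
  encode p := boolPair (encodeNat p.1) (boolPair (encodeNat p.2.1)
    (boolPair (encodeNat p.2.2) (encodingListNatBool.encode p.2.1.primeFactorsList)))
  decode w := some (decodeNat (boolUnpair w).1, decodeNat (boolUnpair (boolUnpair w).2).1,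
    decodeNat (boolUnpair (boolUnpair (boolUnpair w).2).2).1)
  decode_encode p := by
    simp only [boolUnpair_boolPair, decode_encodeNat]

/-- The code of `(a, b, c)` under `encodingQuadCongFactored`. [folklore] -/
@[simp] theorem encodingQuadCongFactored_encode (a b c : ℕ) :
    encodingQuadCongFactored.encode (a, b, c) =
      boolPair (encodeNat a) (boolPair (encodeNat b)
        (boolPair (encodeNat c) (encodingListNatBool.encode b.primeFactorsList))) :=
  rfl

/-- QUADRATIC CONGRUENCES WITH FACTORISATION over `{0,1}`: the same yes-instances `quadCongSet`,
but each instance is presented together with the prime factorisation of its modulus `b`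
(`encodingQuadCongFactored`). A string lies in this language iff it is the code of a yes-instance
`(a, b, c)` followed by the correct factorisation of `b` (Garey–Johnson [AN1] Comment;
Manders–Adleman 1978 §2 Remark).
[cite: GareyJohnson1979, §A7.1 problem AN1 (Comment)] -/
def QUADCONGFACT : Language Bool :=
  encodingQuadCongFactored.toLanguage quadCongSet

/-- Membership of a code word in `QUADCONGFACT` is membership of the instance in `quadCongSet`.
[folklore] -/
theorem boolPair_mem_QUADCONGFACT_iff (a b c : ℕ) :
    boolPair (encodeNat a) (boolPair (encodeNat b)
        (boolPair (encodeNat c) (encodingListNatBool.encode b.primeFactorsList))) ∈ QUADCONGFACT ↔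
      (a, b, c) ∈ quadCongSet :=
  encodingQuadCongFactored.mem_toLanguage_iff quadCongSet (a, b, c)

/-- `QUADCONGFACT` fully unfolded over strings.
[cite: GareyJohnson1979, §A7.1 problem AN1 (Comment)] -/
theorem mem_QUADCONGFACT_iff (w : List Bool) :
    w ∈ QUADCONGFACT ↔ ∃ a b c : ℕ,
      w = boolPair (encodeNat a) (boolPair (encodeNat b)
            (boolPair (encodeNat c) (encodingListNatBool.encode b.primeFactorsList))) ∧
        0 < a ∧ 0 < b ∧ ∃ x : ℕ, 0 < x ∧ x < c ∧ x ^ 2 ≡ a [MOD b] := by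
  constructor
  · rintro ⟨⟨a, b, c⟩, hp, rfl⟩
    exact ⟨a, b, c, rfl, (mem_quadCongSet_iff a b c).1 hp⟩
  · rintro ⟨a, b, c, rfl, h⟩
    exact ⟨(a, b, c), (mem_quadCongSet_iff a b c).2 h, rfl⟩

/-- The factorisation component of a `QUADCONGFACT` instance is a genuine prime factorisation of
the (positive) modulus: every entry is prime and the product is `b` (Mathlib
`Nat.prime_of_mem_primeFactorsList`, `Nat.prod_primeFactorsList`). [folklore] -/
theorem primeFactorsList_spec_of_mem_quadCongSet {a b c : ℕ} (h : (a, b, c) ∈ quadCongSet) :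
    (∀ p ∈ b.primeFactorsList, p.Prime) ∧ b.primeFactorsList.prod = b :=
  ⟨fun _ hp => Nat.prime_of_mem_primeFactorsList hp,
    Nat.prod_primeFactorsList (Nat.pos_iff_ne_zero.1 ((mem_quadCongSet_iff a b c).1 h).2.1)⟩

/-! ### NP-completeness (named facts) -/

/-- **Manders–Adleman 1978; Garey–Johnson [AN1].** QUADRATIC CONGRUENCES is NP-complete
(membership in NP: guess `x < c`; hardness: polynomial-time transformation from 3SAT).
Manders–Adleman prove it for the side condition `0 ≤ x ≤ γ`; Garey–Johnson state it for the
wording formalised here (`a, b, c` positive, `0 < x < c`), citing Manders–Adleman; the original is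
K. L. Manders, L. Adleman, J. Comput. System Sci. 16 (1978) 168–184, §2 Theorem 2 (bib key
`MandersAdleman1978`).
[cite: GareyJohnson1979, §A7.1 problem AN1] -/
def isNPComplete_QUADCONG : Prop :=
  IsNPComplete QUADCONG

/-- **Manders–Adleman 1978, Remark; Garey–Johnson [AN1], Comment.** QUADRATIC CONGRUENCES
remains NP-complete when every instance carries the prime factorisation of its modulus `b`
("the problems are still NP-complete when `β` is given in fully factored form"; Garey–Johnson:
"even if the instance includes a prime factorization of `b` and solutions to the congruence
modulo all prime powers occurring in the factorization" — only the factorisation part is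
formalised, see `QUADCONGFACT`). Scope note for users: the moduli produced by the
Manders–Adleman transformation have every odd prime factor at multiplicity `≥ n + 1`; nothing is
asserted here about squarefree moduli. Sources: Manders–Adleman 1978, §2, Remark preceding the
reduction (bib key `MandersAdleman1978`), and Garey–Johnson [AN1], Comment (tag below).
[cite: GareyJohnson1979, §A7.1 problem AN1 (Comment)] -/
def isNPComplete_QUADCONGFACT : Prop :=
  IsNPComplete QUADCONGFACT

end Literature.Computability.Complexity
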